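import Summits.Langlands.Langlands.Theorems.IrreducibilityBySelfDualityPairLBoundaryJSGapUnitBoxPeel

/-!
# Crux `PairLBoundaryJS` (stmt-Langlands-13622), line `Sketch` — stub `stub_gap_unitBox_productForm` (G-PF):
# support collapse and product form of the translated `GL_n × GL_m` pair integrand on the unit box

Summit `Langlands`, sub-problem `Langlands`, helper file under `Theorems/` supporting the crux
`PairLBoundaryJS` (Arthur–Clozel (1989), Ch. 3, (2.2)), line `Sketch`, registered stub
`stub_gap_unitBox_productForm` (part 3 of 3: parts 1–2 are `…GapUnitBoxLocalValue`, `…GapUnitBoxPeel`). This is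
the `GL_n × GL_m` (`0 < m < n`) generalisation of the corner file `…CornerUnitBoxProductForm` (`GL_{m+1} × GL_m`).

The bad-place step of the Rankin–Selberg method for the pair `GL_n × GL_m`, `m < n`
(Jacquet–Piatetski-Shapiro–Shalika (1983), §2, (2.7): at a finite place the local integral of suitable data is a
non-zero constant; Cogdell (2004), §4.1: `Ψ = ∏_v Ψ_v` for factorizable data), in the tree's torus coordinates
and abstractly in `W` on `GL_n(𝔸_K)` and `W'` on `GL_m(𝔸_K)`, with INDEPENDENT torus shifts `T ∈ (𝔸_Kˣ)ⁿ` and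
`τ ∈ (𝔸_Kˣ)ᵐ` trivial at the bad places. Along the corner `ι = glCorner (m ≤ n) : g ↦ diag(g, 1_{n-m})` the last
row is exactly `e_n`, so there is no test function and no depth hypothesis.

* `setIntegral_gap_eq_unitBox_univ` — **part (i)**: the pair integrand of `W(diag(T) ι ·)` over `B({v ∉ Bad}) × K`
  equals its integral over `B(all) × K` (the support theorem `valued_eq_one_of_gap_ne_zero` of part 2 at every
  `v ∈ Bad`, where `diag(T)_v = 1`);
* `stub_gap_unitBox_productForm` — **the registered stub**: (i), and (ii) the product form on `B(all) × K`,
  `I(p) = F((diag a k)_f) · W(diag(T) (ι(diag a k)_∞, 1)) · W̄'(diag τ ((diag a k)_∞, 1)) · |det a|_∞^s δ⁻¹` with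
  `F(κ) = ∏_{v ∈ Bad} 𝟙[ι(κ_v) ∈ N_v K♯_v]` (the local value theorem `gap_pair_apply_mul_ofLocal_eq` of part 1 at each
  `v ∈ Bad`, at a common depth `d` below all the levels and at the base points `diag(T) ι(g')`, `diag(τ) g'`, peeled
  by `gap_pair_eq_prod_mul_pair` of part 2 applied to `W(diag(T) ·)` and `W'(diag(τ) ·)` from the base point
  `((diag a k)_∞, 1)`); `F ∈ {0, 1}`, `F(1) = 1`, and `F` is right `K_f(𝔪)`-invariant for `𝔪 = ∏_{v ∈ Bad} 𝔭_v^d`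
  (`exists_sharp_mul_iff` on `GL_n`); the weight factor is `torusWeightC_eq_archTorusWeightC`.

All proofs complete; tree theorems only.

## References

* H. Jacquet, I. I. Piatetski-Shapiro, J. A. Shalika, *Rankin–Selberg convolutions*, Amer. J. Math.
  105 (1983), §2, (2.7) [JacquetPiatetskiShapiroShalika1983].
* J. W. Cogdell, *Analytic theory of L-functions for GL_n*, in *An Introduction to the Langlands
  Program* (2004), §2.3, §4.1 [CogdellAnalyticTheory2004].
-/

noncomputable section

-- `Summit.Langlands.Langlands.…` (summit = sub-problem name, D-0017 layout) trips `dupNamespace`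
set_option linter.dupNamespace false

open scoped MatrixGroups Topology Pointwise ENNReal NNReal ComplexConjugate InnerProductSpace ContDiff
-- the place subtypes indexing `mixedSpace K` are `Fintype` classically (`NormedCommRing (mixedSpace K)`)
open scoped Classical Matrix.Norms.Operator
open NumberField IsDedekindDomain MeasureTheory Measure Matrix Set Filter WithZero
open NumberField.mixedEmbedding
open Literature.NumberTheory.Automorphic AdelicGroupData
open Literature.NumberTheory.GaloisRepresentations (ideleGroup HeckeCharacter)
open Literature.MeasureTheory.Group
open Literature.RingTheory.SymmetricFunctions.SymmPoly
open ValuativeRel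

-- the automorphic quotient carries the tree's Borel σ-algebra, not Mathlib's quotient σ-algebra
attribute [-instance] Quotient.instMeasurableSpace QuotientGroup.measurableSpace

-- the house local instances, exactly as in `RankinSelbergUnfoldingIdentity`
attribute [local instance] adelicBorel borelSpace_adelic locallyCompactSpace_adelic secondCountableTopology_gl_adelic
  glAdeleBorel borelSpace_glAdele borelSpace_ideleGroup secondCountableTopology_ideleGroup

-- Mathlib idiom: the commutator Lie ring on matrices, to mention `(archGroupGL n K).lie`
attribute [local instance 100] LieRing.ofAssociativeRing

namespace Summit.Langlands.Langlands.Theorems.GapUnitBoxProductForm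

/-! ### Part (i): the support collapse for the translated `GL_n × GL_m` pair -/

section Collapse

variable {m n : ℕ} {K : Type} [Field K] [NumberField K]
  [MeasurableSpace (AdeleRing (𝓞 K) K)] [BorelSpace (AdeleRing (𝓞 K) K)]

/-- **Reduction of the `Bad`-integral of the TRANSLATED `GL_{n+1} × GL_m` pair to the unit box at all finite
places** (`m ≤ n`). For `W` on `GL_{n+1}(𝔸_K)` left `ψ`-equivariant, central up to modulus one and spread at every
`v ∈ T` (no depth hypothesis), a torus element `D ∈ (𝔸_Kˣ)ⁿ⁺¹` trivial at the places of `T` and ANY second factor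
`W₂` on `GL_m(𝔸_K)`, the pair integrand of `(W(diag(D) ι ·), W₂, 1)` over `B({v ∉ T}) × K` equals its integral over
`B(all) × K`: at a point `(a, k)` off the smaller box `W(diag(D) ι(diag a k)) = 0` by the support theorem
`valued_eq_one_of_gap_ne_zero` at a place `v ∈ T` where some `a_i` is not a unit (`diag(D)_v = 1`). [folklore] -/
theorem setIntegral_gap_eq_unitBox_univ (h : m ≤ n + 1) (hm : m ≤ n)
    {ψ : AddChar (AdeleRing (𝓞 K) K) Circle} {W : GL (Fin (n + 1)) (AdeleRing (𝓞 K) K) → ℂ}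
    (hWN : ∀ (u : ↥(adelicUnipotent (n + 1) K)) (g : GL (Fin (n + 1)) (AdeleRing (𝓞 K) K)),
      W ((u : GL (Fin (n + 1)) (AdeleRing (𝓞 K) K)) * g) = whittakerCharFun ψ u * W g)
    (hWZ : ∀ (z : ideleGroup K) (g : GL (Fin (n + 1)) (AdeleRing (𝓞 K) K)),
      ‖W (Matrix.GeneralLinearGroup.scalar (Fin (n + 1)) z * g)‖ = ‖W g‖)
    {T : Finset (HeightOneSpectrum (𝓞 K))} (D : Fin (n + 1) → ideleGroup K)
    (hDT : ∀ v ∈ T, localComponent v (glDiagonal (n + 1) (AdeleRing (𝓞 K) K) D) = 1)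
    (hT : ∀ v ∈ T, ∃ (t : Fin (n + 1) → (v.adicCompletion K)ˣ) (M c₀ : ℤ),
      IsSpreadWhittakerAt v ψ t M W ∧
      (∃ y : v.adicCompletion K, Valued.v y ≤ exp (1 - c₀) ∧ ψ.adicComponent v y ≠ 1) ∧ 1 ≤ M ∧
      (∀ i j : Fin (n + 1), i ≤ j → Valued.v (t j : v.adicCompletion K) ≤ Valued.v (t i : v.adicCompletion K)) ∧
      (∀ i j : Fin (n + 1), (i : ℕ) + 1 = j →
        exp (M - c₀) * Valued.v (t j : v.adicCompletion K) ≤ Valued.v (t i : v.adicCompletion K)))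
    (W₂ : GL (Fin m) (AdeleRing (𝓞 K) K) → ℂ) (s : ℂ)
    (νA : Measure (Fin m → ideleGroup K)) (νK : Measure ↥(maximalCompactAdelic m K)) :
    ∫ p in unitBox {v | v ∉ (↑T : Set (HeightOneSpectrum (𝓞 K)))} ×ˢ Set.univ,
        torusPairIntegrandC m K (fun g => W (glDiagonal (n + 1) (AdeleRing (𝓞 K) K) D *
          glCorner (AdeleRing (𝓞 K) K) h g)) W₂ (fun _ => (1 : ℝ)) s p ∂(νA.prod νK) =
      ∫ p in unitBox (Set.univ : Set (HeightOneSpectrum (𝓞 K))) ×ˢ Set.univ,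
        torusPairIntegrandC m K (fun g => W (glDiagonal (n + 1) (AdeleRing (𝓞 K) K) D *
          glCorner (AdeleRing (𝓞 K) K) h g)) W₂ (fun _ => (1 : ℝ)) s p ∂(νA.prod νK) := by
  classical
  set S₁ : Set ((Fin m → ideleGroup K) × ↥(maximalCompactAdelic m K)) :=
    unitBox {v | v ∉ (↑T : Set (HeightOneSpectrum (𝓞 K)))} ×ˢ Set.univ with hS₁
  set S₂ : Set ((Fin m → ideleGroup K) × ↥(maximalCompactAdelic m K)) :=
    unitBox (Set.univ : Set (HeightOneSpectrum (𝓞 K))) ×ˢ Set.univ with hS₂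
  have hsub : S₂ ⊆ S₁ := by
    rintro ⟨a, k⟩ ⟨ha, -⟩
    exact ⟨fun w _ i => ha w (Set.mem_univ w) i, Set.mem_univ _⟩
  have hS₁m : MeasurableSet S₁ := (measurableSet_unitBox _).prod MeasurableSet.univ
  refine setIntegral_eq_of_subset_of_forall_sdiff_eq_zero hS₁m hsub ?_
  rintro ⟨a, k⟩ ⟨hp, hnot⟩
  by_contra hne
  apply hnot
  have hW0 : W (glDiagonal (n + 1) (AdeleRing (𝓞 K) K) D *
      glCorner (AdeleRing (𝓞 K) K) h (torusPoint m K (a, k))) ≠ 0 := by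
    intro h0
    apply hne
    simp only [torusPairIntegrandC, h0, zero_mul]
  refine ⟨fun w _ i => ?_, Set.mem_univ _⟩
  by_cases hw : w ∈ T
  · obtain ⟨t, M, c₀, hWv, hψv, hM₁, hmono, hgap⟩ := hT w hw
    exact valued_eq_one_of_gap_ne_zero h hm hWN hWZ hWv hψv hM₁ hmono hgap (hDT w hw) a k hW0 i
  · exact hp.1 w hw i

end Collapse

/-! ### The registered stub -/

/-- **STUB (G-PF) — support collapse and product form of the translated `GL_n × GL_m` pair integrand on the unit
box** (the `GL_n × GL_m`, `0 < m < n`, version of `CornerUnitBoxProductForm.stub_corner_unitBox_productForm`;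
Jacquet–Piatetski-Shapiro–Shalika (1983), §2, (2.7): at a finite place the local integral of suitable data is a
non-zero constant; Cogdell (2004), §4.1: `Ψ = ∏_v Ψ_v` for factorizable data). Abstractly in two functions: `W` on
`GL_n(𝔸_K)` left `ψ`-equivariant, central up to modulus one, right `K_f(𝔫)`-invariant with the primes of `𝔫` in
`Bad`, spread at every `v ∈ Bad` (`IsSpreadWhittakerAt` for `Fin n`, the inequalities of the support theorem WITHOUT
the depth inequality — along `diag(h, 1_{n-m})` the rows of index `≥ m` are standard basis vectors, so the thin
condition holds at every depth); `W'` on `GL_m(𝔸_K)` left `ψ`-equivariant, right `K_f(𝔫)`- and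
`K_v(𝔭^M)`-invariant; torus shifts `τ ∈ (𝔸_Kˣ)ᵐ`, `T ∈ (𝔸_Kˣ)ⁿ` trivial at `Bad`;
`I(s) = torusPairIntegrandC m K (W(diag(T) ι ·)) (W̄'(diag τ ·)) 1 s` (`ι = glCorner (m ≤ n)`). (i)
`∫_{B({v ∉ Bad}) × K} I = ∫_{B(all) × K} I`; (ii) on `B(all) × K`,
`I(p) = F((diag a k)_f) · W(diag(T) (ι(diag a k)_∞, 1)) · conj W'(diag τ ((diag a k)_∞, 1)) · |det a|_∞^s δ⁻¹` with
`F ∈ {0, 1}`, `F(1) = 1`, `F` right `K_f(𝔪)`-invariant on `GL_m(𝒪̂)` for some `𝔪 ≠ 0` (write `n = n' + 1`;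
`setIntegral_gap_eq_unitBox_univ`; `gap_pair_apply_mul_ofLocal_eq` at each `v ∈ Bad` at a common depth and at the
base points `diag(T) ι(g')`, `diag(τ) g'` — at `v ∈ Bad` simply `T_v = 1`, `τ_v = 1`, no merging of the two shifts
is needed; peeled by `gap_pair_eq_prod_mul_pair`; `torusWeightC_eq_archTorusWeightC`).
[cite: JacquetPiatetskiShapiroShalika1983, §2 (2.7)] [cite: CogdellAnalyticTheory2004, §4.1] -/
theorem stub_gap_unitBox_productForm :
    ∀ {n m : ℕ} {K : Type} [Field K] [NumberField K]
      [MeasurableSpace (AdeleRing (𝓞 K) K)] [BorelSpace (AdeleRing (𝓞 K) K)] (_hm : 0 < m) (hmn : m < n)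
      (W : GL (Fin n) (AdeleRing (𝓞 K) K) → ℂ) (W' : GL (Fin m) (AdeleRing (𝓞 K) K) → ℂ)
      (_ : ∀ (u : ↥(adelicUnipotent n K)) (g : GL (Fin n) (AdeleRing (𝓞 K) K)),
        W ((u : GL (Fin n) (AdeleRing (𝓞 K) K)) * g) = whittakerCharFun (adeleAddChar K) u * W g)
      (_ : ∀ (u : ↥(adelicUnipotent m K)) (g : GL (Fin m) (AdeleRing (𝓞 K) K)),
        W' ((u : GL (Fin m) (AdeleRing (𝓞 K) K)) * g) = whittakerCharFun (adeleAddChar K) u * W' g)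
      (_ : ∀ (z : ideleGroup K) (g : GL (Fin n) (AdeleRing (𝓞 K) K)),
        ‖W (Matrix.GeneralLinearGroup.scalar (Fin n) z * g)‖ = ‖W g‖)
      {𝔫 : Ideal (𝓞 K)} (_ : 𝔫 ≠ 0)
      (_ : ∀ u ∈ finitePrincipalCongruenceLevel n K 𝔫, ∀ g : GL (Fin n) (AdeleRing (𝓞 K) K),
        W (g * GLn.ofFinite n K u) = W g)
      (_ : ∀ u ∈ finitePrincipalCongruenceLevel m K 𝔫, ∀ g : GL (Fin m) (AdeleRing (𝓞 K) K),
        W' (g * GLn.ofFinite m K u) = W' g)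
      {Bad : Finset (HeightOneSpectrum (𝓞 K))} (_ : ∀ w : HeightOneSpectrum (𝓞 K), w.asIdeal ∣ 𝔫 → w ∈ Bad)
      (τ : Fin m → ideleGroup K) (_ : ∀ v ∈ Bad, localComponent v (glDiagonal m (AdeleRing (𝓞 K) K) τ) = 1)
      (T : Fin n → ideleGroup K) (_ : ∀ v ∈ Bad, localComponent v (glDiagonal n (AdeleRing (𝓞 K) K) T) = 1)
      (_ : ∀ v ∈ Bad, ∃ (tv : Fin n → (v.adicCompletion K)ˣ) (M c₀ : ℤ),
          IsSpreadWhittakerAt v (adeleAddChar K) tv M W ∧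
          (∃ y : v.adicCompletion K, Valued.v y ≤ exp (1 - c₀) ∧ (adeleAddChar K).adicComponent v y ≠ 1) ∧ 1 ≤ M ∧
          (∀ i j : Fin n, i ≤ j → Valued.v (tv j : v.adicCompletion K) ≤ Valued.v (tv i : v.adicCompletion K)) ∧
          (∀ i j : Fin n, (i : ℕ) + 1 = j →
            exp (M - c₀) * Valued.v (tv j : v.adicCompletion K) ≤ Valued.v (tv i : v.adicCompletion K)) ∧
          ∀ κ ∈ valuedCongruenceSubgroup (Fin m) (exp (-M)), ∀ g : GL (Fin m) (AdeleRing (𝓞 K) K),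
            W' (g * GLn.ofLocal m K v κ) = W' g)
      (νA : Measure (Fin m → ideleGroup K)) (νK : Measure ↥(maximalCompactAdelic m K)),
    let I : ℂ → (Fin m → ideleGroup K) × ↥(maximalCompactAdelic m K) → ℂ :=
      fun s => torusPairIntegrandC m K
        (fun g => W (glDiagonal n (AdeleRing (𝓞 K) K) T * glCorner (AdeleRing (𝓞 K) K) hmn.le g))
        (fun g => star W' (glDiagonal m (AdeleRing (𝓞 K) K) τ * g)) (fun _ => (1 : ℝ)) s
    ∃ (𝔪 : Ideal (𝓞 K)) (_ : 𝔪 ≠ 0) (F : GL (Fin m) (FiniteAdeleRing (𝓞 K) K) → ℂ),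
      (∀ g ∈ glFiniteIntegralLevel m K, ∀ u ∈ finitePrincipalCongruenceLevel m K 𝔪, F (g * u) = F g) ∧
      (∀ g, F g = 0 ∨ F g = 1) ∧ F 1 = 1 ∧
      ∀ s : ℂ,
        (∫ p in unitBox {v | v ∉ (↑Bad : Set (HeightOneSpectrum (𝓞 K)))} ×ˢ Set.univ, I s p ∂(νA.prod νK) =
          ∫ p in unitBox (Set.univ : Set (HeightOneSpectrum (𝓞 K))) ×ˢ Set.univ, I s p ∂(νA.prod νK)) ∧
        ∀ p : (Fin m → ideleGroup K) × ↥(maximalCompactAdelic m K),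
          p.1 ∈ unitBox (n := m) (K := K) (Set.univ : Set (HeightOneSpectrum (𝓞 K))) →
          I s p = F (GLn.sndHom m K (torusPoint m K p)) *
            (W (glDiagonal n (AdeleRing (𝓞 K) K) T *
              GLn.ofInfinite n K (glCorner (mixedSpace K) hmn.le (GLn.toMixed m K (torusPoint m K p)))) *
            conj (W' (glDiagonal m (AdeleRing (𝓞 K) K) τ * GLn.ofInfinite m K (GLn.toMixed m K (torusPoint m K p)))) *
            archTorusWeightC m K s (archTorusOfIdele m K p.1)) := by
  intro n m K _ _ _ _ _hm hmn W W' hWN hW'N hWZ 𝔫 h𝔫 hWK hW'K Bad hBad τ hτ T hT hsp νA νK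
  -- `n = n' + 1`, `m ≤ n'`
  obtain ⟨n, rfl⟩ : ∃ n', n = n' + 1 := ⟨n - 1, by omega⟩
  have hm : m ≤ n := Nat.lt_succ_iff.1 hmn
  dsimp only
  choose tv M c₀ hspW hψv hM1 hmono hgap hW'Kv using hsp
  -- a common depth `d` below all the levels: `exp(-d)|t_0| ≤ exp(-M_v)|t_n|` at every `v ∈ Bad`
  have hdepth : ∀ v (hv : v ∈ Bad), ∃ N : ℕ, exp (-(N : ℤ)) * Valued.v (tv v hv 0 : v.adicCompletion K) ≤
      exp (-(M v hv)) * Valued.v (tv v hv (Fin.last n) : v.adicCompletion K) := fun v hv =>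
    CornerUnitBoxProductForm.exists_nat_exp_neg_mul_le ((Valuation.ne_zero_iff _).2 (tv v hv (Fin.last n)).ne_zero)
      (M v hv)
  choose N hN using hdepth
  set d : ℕ := ∑ w ∈ Bad.attach, N w.1 w.2 with hd
  have hmt : ∀ v (hv : v ∈ Bad), exp (-(d : ℤ)) * Valued.v (tv v hv 0 : v.adicCompletion K) ≤
      exp (-(M v hv)) * Valued.v (tv v hv (Fin.last n) : v.adicCompletion K) := fun v hv => by
    have hle : N v hv ≤ d :=
      Finset.single_le_sum (f := fun w : {w // w ∈ Bad} => N w.1 w.2) (fun _ _ => Nat.zero_le _)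
        (Finset.mem_attach Bad ⟨v, hv⟩)
    exact (mul_le_mul_left (exp_le_exp.2 (by omega)) _).trans (hN v hv)
  -- the level `𝔪 = ∏_{v ∈ Bad} 𝔭_v^d`
  have h𝔪0 : (∏ v ∈ Bad, v.asIdeal ^ d : Ideal (𝓞 K)) ≠ 0 := UnitBoxTranslateProductForm.prod_pow_asIdeal_ne_zero Bad d
  have h𝔪rad : ∀ v ∈ Bad, idealRadius K v (∏ w ∈ Bad, w.asIdeal ^ d) ≤ exp (-(d : ℤ)) := fun v hv =>
    UnitBoxTranslateProductForm.idealRadius_prod_pow_le d hv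
  -- the local indicators `J_v = 𝟙[ι(·) ∈ N_v K♯_v]` (`1` off `Bad`)
  set J : (v : HeightOneSpectrum (𝓞 K)) → GL (Fin m) (v.adicCompletion K) → ℂ := fun v x =>
    if hv : v ∈ Bad then
      (if ∃ u ∈ upperUnitriangular (Fin (n + 1)) (v.adicCompletion K), ∃ k : GL (Fin (n + 1)) (v.adicCompletion K),
          (k ∈ valuedCongruenceSubgroup (Fin (n + 1)) (exp (-(M v hv))) ∧
            ∀ g : GL (Fin (n + 1)) (AdeleRing (𝓞 K) K), W (g * GLn.ofLocal (n + 1) K v k) = W g) ∧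
            glCorner (v.adicCompletion K) hmn.le x = u * k
        then 1 else 0)
    else 1 with hJdef
  -- the translated functions `W(diag(T) ·)`, `W'(diag(τ) ·)`
  set W₁ : GL (Fin (n + 1)) (AdeleRing (𝓞 K) K) → ℂ := fun G => W (glDiagonal (n + 1) (AdeleRing (𝓞 K) K) T * G)
    with hW₁
  set W₁' : GL (Fin m) (AdeleRing (𝓞 K) K) → ℂ := fun g => W' (glDiagonal m (AdeleRing (𝓞 K) K) τ * g) with hW₁'
  have hW₁K : ∀ u ∈ finitePrincipalCongruenceLevel (n + 1) K 𝔫, ∀ G : GL (Fin (n + 1)) (AdeleRing (𝓞 K) K),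
      W₁ (G * GLn.ofFinite (n + 1) K u) = W₁ G := fun u hu G => by
    simp only [hW₁]
    rw [← mul_assoc]
    exact hWK u hu _
  have hW₁'K : ∀ u ∈ finitePrincipalCongruenceLevel m K 𝔫, ∀ g : GL (Fin m) (AdeleRing (𝓞 K) K),
      W₁' (g * GLn.ofFinite m K u) = W₁' g := fun u hu g => by
    simp only [hW₁']
    rw [← mul_assoc]
    exact hW'K u hu _
  have hJ : ∀ v ∈ Bad, ∀ g' : GL (Fin m) (AdeleRing (𝓞 K) K), localComponent v g' = 1 →
      ∀ x : GL (Fin m) (v.adicCompletion K),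
        W₁ (glCorner (AdeleRing (𝓞 K) K) hmn.le (g' * GLn.ofLocal m K v x)) * star (W₁' (g' * GLn.ofLocal m K v x)) =
          J v x * (W₁ (glCorner (AdeleRing (𝓞 K) K) hmn.le g') * star (W₁' g')) := by
    intro v hv g' hg' x
    simp only [hJdef, dif_pos hv, hW₁, hW₁']
    rw [map_mul, CornerPairTranslate.glCorner_ofLocal, ← mul_assoc, ← mul_assoc]
    have hG' : localComponent v (glDiagonal (n + 1) (AdeleRing (𝓞 K) K) T * glCorner (AdeleRing (𝓞 K) K) hmn.le g') = 1 := by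
      rw [UnitBoxTranslateProductForm.localComponent_mul, hT v hv, one_mul, CornerPairTranslate.localComponent_glCorner,
        hg', map_one]
    have hg'' : localComponent v (glDiagonal m (AdeleRing (𝓞 K) K) τ * g') = 1 := by
      rw [UnitBoxTranslateProductForm.localComponent_mul, hτ v hv, hg', one_mul]
    exact gap_pair_apply_mul_ofLocal_eq hmn.le hm hWN hW'N (hspW v hv) (hψv v hv) (hM1 v hv) (hmono v hv) (hgap v hv)
      (hmt v hv) (hW'Kv v hv) hG' hg'' x
  have hJ01 : ∀ v ∈ Bad, ∀ x : GL (Fin m) (v.adicCompletion K), J v x = 0 ∨ J v x = 1 := by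
    intro v hv x
    simp only [hJdef, dif_pos hv]
    split_ifs
    · exact Or.inr rfl
    · exact Or.inl rfl
  refine ⟨∏ v ∈ Bad, v.asIdeal ^ d, h𝔪0, fun κ => ∏ v ∈ Bad, J v (localComponent v (GLn.ofFinite m K κ)),
    ?_, ?_, ?_, fun s => ⟨?_, ?_⟩⟩
  · -- right `K_f(𝔪)`-invariance
    intro g _ u hu
    have hu' : ∀ v ∈ Bad, glCorner (v.adicCompletion K) hmn.le (localComponent v (GLn.ofFinite m K u)) ∈
        valuedCongruenceSubgroup (Fin (n + 1)) (exp (-(d : ℤ))) := fun v hv =>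
      (glCorner_mem_valuedCongruenceSubgroup_iff hmn.le _).2 (valuedCongruenceSubgroup_mono (Fin m) (h𝔪rad v hv)
        (((mem_principalCongruenceLevel_iff).1 (mem_finitePrincipalCongruenceLevel_iff.1 hu)).2 v))
    refine Finset.prod_congr rfl fun v hv => ?_
    rw [map_mul, UnitBoxTranslateProductForm.localComponent_mul]
    simp only [hJdef, dif_pos hv]
    refine if_congr ?_ rfl rfl
    rw [map_mul]
    exact UnitBoxTranslateProductForm.exists_sharp_mul_iff (hspW v hv) (hmono v hv) (hmt v hv) _ (hu' v hv)
  · -- values in `{0, 1}`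
    intro g
    exact UnitBoxTranslateProductForm.prod_eq_zero_or_one Bad fun v hv => hJ01 v hv _
  · -- `F(1) = 1`
    refine Finset.prod_eq_one fun v hv => ?_
    rw [map_one, UnitBoxTranslateProductForm.localComponent_one]
    simp only [hJdef, dif_pos hv]
    rw [if_pos]
    exact ⟨1, one_mem _, 1, ⟨one_mem _, fun g => by rw [map_one, mul_one]⟩, by rw [map_one, one_mul]⟩
  · -- (i) the support collapse
    exact setIntegral_gap_eq_unitBox_univ hmn.le hm hWN hWZ T hT
      (fun v hv => ⟨tv v hv, M v hv, c₀ v hv, hspW v hv, hψv v hv, hM1 v hv, hmono v hv, hgap v hv⟩) _ s νA νK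
  · -- (ii) the product form on the unit box
    rintro ⟨a, k⟩ ha
    dsimp only at ha ⊢
    set tp : GL (Fin m) (AdeleRing (𝓞 K) K) := torusPoint m K (a, k) with htp
    set g₀ : GL (Fin m) (AdeleRing (𝓞 K) K) := GLn.ofInfinite m K (GLn.toMixed m K tp) with hg₀
    simp only [torusPairIntegrandC, Pi.star_apply, Complex.ofReal_one, mul_one]
    have hwt : torusWeightC m K s a = archTorusWeightC m K s (archTorusOfIdele m K a) :=
      torusWeightC_eq_archTorusWeightC s ha
    -- hypotheses of the peeling at `S = Bad`
    have h1 : ∀ v ∈ Bad, localComponent v g₀ = 1 := fun v _ => UnitBoxTranslateProductForm.localComponent_ofInfinite v _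
    have h3 : ∀ w, w ∉ Bad → (localComponent w g₀)⁻¹ * localComponent w tp ∈
        valuedCongruenceSubgroup (Fin m) (1 : ℤᵐ⁰) := fun w _ => by
      rw [hg₀, UnitBoxTranslateProductForm.localComponent_ofInfinite, inv_one, one_mul, ← glInt_adicCompletion_eq]
      exact localComponent_torusPoint_mem_glInt (fun i => ha w (Set.mem_univ w) i) k
    have h4 : GLn.fstHom m K tp = GLn.fstHom m K g₀ := by
      rw [hg₀, GLn.fstHom_ofInfinite, GLn.toMixed_apply, MulEquiv.symm_apply_apply]
    have hkey := gap_pair_eq_prod_mul_pair hmn.le h𝔫 hW₁K hW₁'K hBad J hJ Bad subset_rfl tp g₀ h1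
      (fun w hw hw' => absurd hw' hw) h3 h4
    have hprod : (∏ v ∈ Bad, J v (localComponent v (GLn.ofFinite m K (GLn.sndHom m K tp)))) =
        ∏ v ∈ Bad, J v (localComponent v tp) :=
      Finset.prod_congr rfl fun v _ => by rw [UnitBoxTranslateProductForm.localComponent_ofFinite_sndHom]
    simp only [hW₁, hW₁'] at hkey
    rw [hwt, hprod, hkey, hg₀, glCorner_ofInfinite]
    simp only [starRingEnd_apply]
    ring

end Summit.Langlands.Langlands.Theorems.GapUnitBoxProductForm
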